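import Summits.CriticalPhenomena.PercolationContinuityZ3.Theorems.Transplant.PlanarSkeletonFrmQuasiDefs
import Summits.CriticalPhenomena.PercolationContinuityZ3.Theorems.Transplant.SkelFrmQuasiBChoiceDepth
import Summits.CriticalPhenomena.PercolationContinuityZ3.Theorems.Transplant.SkelFrmBChoiceDepth
import Summits.CriticalPhenomena.PercolationContinuityZ3.Theorems.Transplant.SkelFrmQuasiBChoiceLinks
import Summits.CriticalPhenomena.PercolationContinuityZ3.Theorems.Transplant.SkelFrmBChoiceLinks
import Summits.CriticalPhenomena.PercolationContinuityZ3.Theorems.Transplant.SkelFrmQuasiBParamsSlotsT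
import Summits.CriticalPhenomena.PercolationContinuityZ3.Theorems.Transplant.SkelFrmBParamsSlotsT
import Summits.CriticalPhenomena.PercolationContinuityZ3.Theorems.Transplant.SkelFrmQuasi1ChoiceDefs
import Summits.CriticalPhenomena.PercolationContinuityZ3.Theorems.Transplant.SkelFrmQuasi1ParamsLBL
import Summits.CriticalPhenomena.PercolationContinuityZ3.Theorems.Transplant.SkelFrmQuasi1ParamsPO
import Summits.CriticalPhenomena.PercolationContinuityZ3.Theorems.Transplant.SkelFrmQuasi1SlotTypes
import Summits.CriticalPhenomena.PercolationContinuityZ3.Theorems.Transplant.SkelFrmQuasiBChoiceDefs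
import Summits.CriticalPhenomena.PercolationContinuityZ3.Theorems.Transplant.SkelFrmQuasiBParamsCorrKG
import Summits.CriticalPhenomena.PercolationContinuityZ3.Theorems.Transplant.SkelFrmQuasiBParamsLF
import Summits.CriticalPhenomena.PercolationContinuityZ3.Theorems.Transplant.SkelFrmQuasiBParamsSlotsS
import Summits.CriticalPhenomena.PercolationContinuityZ3.Theorems.Transplant.SkelFrmQuasi1SlotTypes
import Summits.CriticalPhenomena.PercolationContinuityZ3.Theorems.Transplant.SkelFrmQuasiBChoiceNums
import HarnessLib
import Summits.CriticalPhenomena.PercolationContinuityZ3.Theorems.Transplant.SkelFrmBChoiceResidC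
/-!
# GEN-Q PORT (WAVE-Q table v0.8 section 2, row G097, U-level L?; captain R-6/R-7 2026-08-27: carrier token swap `PlanarSkeletonFrmFrom ↦ PlanarSkeletonFrmQuasi`)
# of the tree module «Transplant/SkelFrmFromBChoiceResidC» (sha256 46836adaf2c482c1…) onto the quasi-step carrier `PlanarSkeletonFrmQuasi` (p507026): «SkelFrmQuasiBChoiceResidC»

ORIGINAL TITLE: N2 (frames-only node `SamePDropOfSkeletonFrm₁`, OPEN) — (ζ″) ledger: THE (C)-COLUMN RESIDUAL SLOT FUNCTIONS `NegB.gxC / fxC / exC` AND THEIR FLOOR LEMMAS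

builds on p205010 (kernel theorem, internal audit signed; external expert review pending) — nothing in this file uses p205010; NOTHING is claimed about any open node
((N3-b), the end state).  Lane `prim-bschramm`, seat `prim-bschramm-gen-1` (gen 5; WAVE-Q captain).  Helper file (`--supports stmt-CriticalPhenomena-4575 --as helper`).
PORT RULES (U-wave r1–r4 re-used, GEN-Q hunk classes of p3-g29 #6136): declaration order, names and proof texts are those of «SkelFrmFromBChoiceResidC», byte-identical except
(i) the carrier token `PlanarSkeletonFrmFrom ↦ PlanarSkeletonFrmQuasi` in binders, `namespace`/`end` lines and qualified names (module names `SkelFrmFrom… ↦ SkelFrmQuasi…`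
in imports of already-ported rows); (ii) `Φ.step ↦ Φ.qstep` with the called Steps lemma replaced by its `…Q`/`_q` twin and the cost `Φ.M` threaded (none in this file unless
listed below); (iii) `Φ.cyl_connected ↦ Φ.cyl_reach` readers (none unless listed); (iv) graph-ball radii / window floors ×`Φ.M` (none unless listed); (v) KS0 READER HUNK of record (L-KitS-1 / L-FLOORMAP-1 ①, stmt-g33's table #6324, tool T6): the (S0) kit data
of «SkelFrmQuasiBChoiceNums» (G017) are N-parametrised and read at `N := KS.NQ Φ = 13·max Φ.M 1` — IN THIS FILE KS0.R'0N ×22, KS0.r₀0N ×5 (e.g. `KS0.R'0 κ Φ … ↦ KS0.R'0N κ Φ (KS.NQ Φ) …`), nothing else.  Carrier-free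
residents stay imported/exported from the original «SkelFrmBChoiceResidC» exactly as in the FrmFrom port.  Docstrings and citations are the original's.
Row G097 (gen-1 g5, captain R-19).
-/

open scoped Classical

noncomputable section

namespace Summit.CriticalPhenomena.PercolationContinuityZ3.Theorems.Transplant

namespace PlanarSkeletonFrmQuasi

export PlanarSkeletonNeg.Neg (K Kq)  -- T3-auto: resident alias(es) replicated from the FrmFrom namespace

namespace NegB

open Literature.Probability.Percolation Literature.Probability.LatticeModels SimpleGraph
open SkelConc (Consts)
open Skelφ.StepI (DataNS OutNS)
open Neg

/-! ## §1 The kit-prism radius read at `(D, g, f)` -/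

section RLD

variable (κ : Consts) {V : Type} [DecidableEq V] [Countable V] {G : SimpleGraph V} [G.LocallyFinite] (Φ : PlanarSkeletonFrmQuasi G) (t : V) (p : unitInterval)

/-- **p3-g16's long link region's prism radius `RL`, read at `(D, g, f)`** (so that it is a floor on the excess slot `ex : GSlot`). [this work] -/
def RLD (κ : Consts) {V : Type} [DecidableEq V] [Countable V] {G : SimpleGraph V} [G.LocallyFinite] (Φ : PlanarSkeletonFrmQuasi G) (t : V) (p : unitInterval) (D : DataNS V) (g f : ℕ) : ℕ := D.R (D.toDataN.scale t (ML κ Φ t p D g) (nL κ Φ t p D g f))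

/-- `RL κ Φ t p O gv fv = RLD κ Φ t p O.merged (gOf …) (fOf …)` (by `rfl`). [folklore] -/
theorem RL_eq_RLD (κ : Consts) {V : Type} [DecidableEq V] [Countable V] {G : SimpleGraph V} [G.LocallyFinite] (Φ : PlanarSkeletonFrmQuasi G) (t : V) (p : unitInterval) (O : OutNS V) (gv fv : Neg.FSlot) : RL κ Φ t p O gv fv = RLD κ Φ t p O.merged (gOf κ Φ t p O gv) (fOf κ Φ t p O fv) := rfl

end RLD

/-! ## §2 The (C)-column residual slot functions -/

/-- **The (C)-column BOX residual** `gxC mk := max {gFloorKG, 40·K·R′0, 22000·Kq·(R′0+2)}`. [this work] -/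
def gxC (mk : ℕ) : Neg.FSlot := fun κ _ _ _ _ _ Φ t p D =>
  max (gFloorKG κ Φ t p D mk) (max (40 * Neg.K κ * KS0.R'0N κ Φ (KS.NQ Φ) t p D mk) (22000 * Neg.Kq κ * (KS0.R'0N κ Φ (KS.NQ Φ) t p D mk + 2)))

/-- **The (C)-column WIDTH residual** `fxC mk := 2000·Kq·(R′0+2)`. [this work] -/
def fxC (mk : ℕ) : Neg.FSlot := fun κ _ _ _ _ _ Φ t p D => 2000 * Neg.Kq κ * (KS0.R'0N κ Φ (KS.NQ Φ) t p D mk + 2)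

/-- **The (C)-column EXCESS residual** `exC mk := max {KS0.r₀0N (KS.NQ Φ) t D mk (RLD …) + 3, ZD + 4}`. [this work] -/
def exC (mk : ℕ) : GSlot := fun κ _ _ _ _ _ Φ t p D g f => max (KS0.r₀0N (KS.NQ Φ) t D mk (RLD κ Φ t p D g f) + 3) (ZD κ Φ t p D g f + 4)

section Floors

variable (κ : Consts) {V : Type} [DecidableEq V] [Countable V] {G : SimpleGraph V} [G.LocallyFinite] (Φ : PlanarSkeletonFrmQuasi G) (t : V) (p : unitInterval)
  (D : DataNS V) (g f mk : ℕ)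

/-- `gxC` by name. [folklore] -/
theorem gxC_at (κ : Consts) {V : Type} [DecidableEq V] [Countable V] {G : SimpleGraph V} [G.LocallyFinite] (Φ : PlanarSkeletonFrmQuasi G) (t : V) (p : unitInterval) (D : DataNS V) (mk : ℕ) : gxC mk κ Φ t p D = max (gFloorKG κ Φ t p D mk) (max (40 * Neg.K κ * KS0.R'0N κ Φ (KS.NQ Φ) t p D mk) (22000 * Neg.Kq κ * (KS0.R'0N κ Φ (KS.NQ Φ) t p D mk + 2))) := rfl

-- GEN-Q (R-2, captain 2026-08-27): `PlanarSkeletonFrmFrom.NegB.fxC_at` is not in the used cone of the node top — not ported.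

-- GEN-Q (R-2, captain 2026-08-27): `PlanarSkeletonFrmFrom.NegB.exC_at` is not in the used cone of the node top — not ported.

/-- **The three box floors inside `gxC`.** [folklore] -/
theorem gxC_floors (κ : Consts) {V : Type} [DecidableEq V] [Countable V] {G : SimpleGraph V} [G.LocallyFinite] (Φ : PlanarSkeletonFrmQuasi G) (t : V) (p : unitInterval) (D : DataNS V) (mk : ℕ) : gFloorKG κ Φ t p D mk ≤ gxC mk κ Φ t p D ∧ 40 * Neg.K κ * KS0.R'0N κ Φ (KS.NQ Φ) t p D mk ≤ gxC mk κ Φ t p D ∧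
    22000 * Neg.Kq κ * (KS0.R'0N κ Φ (KS.NQ Φ) t p D mk + 2) ≤ gxC mk κ Φ t p D := by
  refine ⟨?_, ?_, ?_⟩ <;> rw [gxC_at] <;> omega

-- GEN-Q (R-2, captain 2026-08-27): `PlanarSkeletonFrmFrom.NegB.exC_floors` is not in the used cone of the node top — not ported.

-- GEN-Q (R-2, captain 2026-08-27): `PlanarSkeletonFrmFrom.NegB.fxC_floor` is not in the used cone of the node top — not ported.

end Floors

/-! ## §3 Transfer to any dominating slot value (the node file's `gxQ/fxQ/exQ ⊒ gxC/fxC/exC`) -/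

section Transfer

variable {κ : Consts} {V : Type} [DecidableEq V] [Countable V] {G : SimpleGraph V} [G.LocallyFinite] {Φ : PlanarSkeletonFrmQuasi G} {t : V} {p : unitInterval} {mk : ℕ}

/-- **HX's `Hg`** from any box slot value dominating `gxC`. [folklore] -/
theorem Hg_of_ge {κ : Consts} {V : Type} [DecidableEq V] [Countable V] {G : SimpleGraph V} [G.LocallyFinite] {Φ : PlanarSkeletonFrmQuasi G} {t : V} {p : unitInterval} {mk : ℕ} {gv : Neg.FSlot} (h : ∀ D : DataNS V, gxC mk κ Φ t p D ≤ gv κ Φ t p D) (D : DataNS V) :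
    gFloorKG κ Φ t p D mk ≤ gv κ Φ t p D ∧ 40 * Neg.K κ * KS0.R'0N κ Φ (KS.NQ Φ) t p D mk ≤ gv κ Φ t p D :=
  ⟨(gxC_floors κ Φ t p D mk).1.trans (h D), (gxC_floors κ Φ t p D mk).2.1.trans (h D)⟩

-- GEN-Q (R-2, captain 2026-08-27): `PlanarSkeletonFrmFrom.NegB.Hex_of_ge` is not in the used cone of the node top — not ported.

-- GEN-Q (R-2, captain 2026-08-27): `PlanarSkeletonFrmFrom.NegB.hR0_of_ge` is not in the used cone of the node top — not ported.

-- GEN-Q (R-2, captain 2026-08-27): `PlanarSkeletonFrmFrom.NegB.hℓA_of_ge` is not in the used cone of the node top — not ported.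

-- GEN-Q (R-2, captain 2026-08-27): `PlanarSkeletonFrmFrom.NegB.hnA_of_ge` is not in the used cone of the node top — not ported.

-- GEN-Q (R-2, captain 2026-08-27): `PlanarSkeletonFrmFrom.NegB.hRn0_of_ge` is not in the used cone of the node top — not ported.

end Transfer

end NegB

end PlanarSkeletonFrmQuasi

end Summit.CriticalPhenomena.PercolationContinuityZ3.Theorems.Transplant

end
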